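import Literature.NumberTheory.GaloisRepresentations.LubinTateColemanUnitsImageModuleTwo
import Literature.NumberTheory.GaloisRepresentations.LubinTateColemanRelativeLogDerivSurjModTwo
import Literature.NumberTheory.GaloisRepresentations.LubinTateUnramifiedTowerIwasawaCyclic
import Mathlib.RingTheory.RootsOfUnity.AlgebraicallyClosed
import HarnessLib

/-!
# The ring data of the `χ`-specialisation `X ↦ ζ − 1` EXIST: for `ζ ∈ 𝒪_{E'}` with `ζ^{2^m} = 1` (`q = 2`) the evaluation
# `κ_ζ : 𝒪_F⟦X⟧ → 𝒪_{E'}`, `X ↦ ζ − 1`, is a ring map over `𝒪_F`, and `φ_m ↦ ζ` extends to a character `χ : Gal(E_m/F) → 𝒪_{E'}`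

De Shalit, *Iwasawa theory of elliptic curves with complex multiplication* (1987), Ch. I §3.1, §3.8 (17): a character `χ` of finite order of
the unramified direction `Gal(E_∞/F)` (`1 + X ↔ φ`) reads the two-variable algebra `Λ(𝒢; 𝒪) = 𝒪⟦X⟧⟦T⟧` through `X ↦ χ(φ) − 1 = ζ − 1`, a
topologically nilpotent element of `𝒪[ζ]`.  `LubinTateColemanUnitsImageSpecializationCharacterTwo` and its Summit-side readers POSIT this
ring data — a finite subextension `E' ⊇ E_m` of `F̄`, a ring map `κ : 𝒪_F⟦X⟧ → 𝒪_{E'}` with `κ ∘ ι = algebraMap` and `κ(X) = ζ − 1`, a character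
`χ : Gal(E_m/F) → 𝒪_{E'}` with `χ(φ_m) = ζ`.  THIS file CONSTRUCTS `κ` and `χ` from `ζ` alone, and `(E', ζ)` itself in characteristic `0`
(everything PROVED, 0 sorry, no definitions — the data are produced as existence statements, by Mathlib's topological evaluation `PowerSeries.aeval`, `monoidHomOfForallMemZpowers` and
`HasEnoughRootsOfUnity (AlgebraicClosure F)`):

* §1 ★ `norm_coe_sub_one_lt_one_of_pow_two_pow_eq_one` — at `q = 2`, **`ζ^{2^m} = 1 ⟹ ‖ζ − 1‖ < 1`** in `𝒪_{E'}` for ANY finite `E' ⊆ F̄`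
  (`(ζ − 1)^{2^m} = ζ^{2^m} + 1 − 2ζr ∈ 2𝒪_{E'}` by `exists_add_pow_prime_pow_eq`, and `‖2‖ < 1`).
* §2 ★★ `exists_ringHom_comp_intBase_eq_of_norm_lt_one` — **for `‖ζ − 1‖ < 1` there is a ring map `κ : 𝒪_F⟦X⟧ → 𝒪_{E'}` with
  `κ ∘ intBase = algebraMap` and `κ(X) = ζ − 1`** (`κ = PowerSeries.aeval` at the topologically nilpotent `ζ − 1`, `𝒪_{E'}` complete and linearly
  topologised); `exists_ringHom_comp_intBase_eq_of_pow_two_pow_eq_one` (§1 + §2).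
* §3 ★ `exists_monoidHom_apply_restrictNormal_eq` — **for `ζ^{p^m} = 1` there is a character `χ : Gal(E_m/F) →* 𝒪_{E'}` with `χ(φ_m) = ζ`**
  (`Gal(E_m/F) = ⟨φ_m⟩` of order `d·p^m`, `frobPow_bijective_cyclic`; `monoidHomOfForallMemZpowers`).
* §4 ★ `exists_intermediateField_le_isPrimitiveRoot` — for `char F = 0`: **a finite subextension `E' ⊇ E₁` of `F̄` with a PRIMITIVE `n`-th root of
  unity `ζ ∈ 𝒪_{E'}` exists** (`F̄` has enough roots of unity, `E' = E₁ ⊔ F(ζ₀)`, `‖ζ₀‖ = 1`).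

So the pair `(E', ζ)` posited by the `χ`-readers — a finite subextension of `F̄` over `E_m` and a `p^m`-th root of unity in it — exists as well
(§4, appended), with `ζ` primitive so that the characters `φ_m ↦ ζ^a` of §3 exhaust the characters of `Gal(E_m/F)` of order dividing `p^m`.
Cell `bsd-print-cf2`, width seat `bsd-line-cf2c-w7` g32 (T11′ of the pen's docket 2026-08-31).

## References
* E. de Shalit, *Iwasawa theory of elliptic curves with complex multiplication* (1987), Ch. I §3.1, §3.8 (16)–(17). [deShalit1987]
* J.-P. Serre, *Local Fields* (1979), Ch. I §4 Prop. 10, Ch. II §1–§2. [SerreLocalFields1979]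
* J. W. S. Cassels, A. Fröhlich (eds.), *Algebraic Number Theory* (1967), Ch. VI (Serre, *Local class field theory*) §3.2 (evaluating power
  series at topologically nilpotent elements of a complete valuation ring). [CasselsFrohlichANT1967]
-/

noncomputable section

namespace Literature.NumberTheory.GaloisRepresentations

section UnitsImageSpecializationCharacterDataTwo

open GaloisRepresentations.IsNonarchimedeanLocalField LubinTate ValuativeRel Field

variable {F : Type} [Field F] [ValuativeRel F] [TopologicalSpace F] [IsNonarchimedeanLocalField F]

attribute [local instance] ltNormUniformSpace ltNormIsUniformAddGroup rk1 nF nE fintypeResidueField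

variable {π : 𝒪[F]} (hπ : (valuation F).IsUniformizer (π : F))
variable (E₁ : IntermediateField F (AlgebraicClosure F)) [FiniteDimensional F E₁]

/-! ### §1. `ζ^{2^m} = 1 ⟹ ‖ζ − 1‖ < 1` at `q = 2` -/

include hπ in
/-- ★ **A `2`-power root of unity of `𝒪_{E'}` is a principal unit** (`q = 2`, `E' ⊆ F̄` any finite subextension): `ζ^{2^m} = 1 ⟹ ‖ζ − 1‖ < 1`.
Proof: `(ζ − 1)^{2^m} = ζ^{2^m} + (−1)^{2^m} − 2ζr = 2(1 − ζr)` (`exists_add_pow_prime_pow_eq`), and `‖2‖ < 1` (`2 ∈ π𝒪_{E'}`).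
[cite: SerreLocalFields1979, Ch. II §1; Ch. IV §4 Prop. 16] [cite: deShalit1987, Ch. I §3.1] -/
theorem norm_coe_sub_one_lt_one_of_pow_two_pow_eq_one (hq : residueFieldCard F = 2) {m : ℕ} {ζ : unitBall E₁} (hζ : ζ ^ 2 ^ m = 1) :
    ‖((ζ - 1 : unitBall E₁) : E₁)‖ < 1 := by
  -- `‖2‖ < 1` in `𝒪_{E'}`
  have h2lt : ‖((2 : unitBall E₁) : E₁)‖ < 1 := by
    obtain ⟨c, hc⟩ := Ideal.mem_span_singleton'.mp (two_mem_span_algebraMap_pi hπ E₁ hq)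
    have e2 : ((2 : unitBall E₁) : E₁) = ((c : unitBall E₁) : E₁) * ((algebraMap 𝒪[F] (unitBall E₁) π : unitBall E₁) : E₁) := by
      rw [← Subring.coe_mul, hc]
    rw [e2, norm_mul]
    calc ‖((c : unitBall E₁) : E₁)‖ * ‖((algebraMap 𝒪[F] (unitBall E₁) π : unitBall E₁) : E₁)‖
        ≤ 1 * ‖((algebraMap 𝒪[F] (unitBall E₁) π : unitBall E₁) : E₁)‖ :=
          mul_le_mul_of_nonneg_right ((mem_unitBall_iff E₁).mp c.2) (norm_nonneg _)
      _ < 1 := by rw [one_mul]; exact norm_algebraMap_pi_lt_one hπ E₁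
  -- `(ζ − 1)^{2^m} ∈ 2𝒪_{E'}`
  obtain ⟨c, hc⟩ : ∃ c : unitBall E₁, (ζ - 1) ^ 2 ^ m = 2 * c := by
    rcases Nat.eq_zero_or_pos m with rfl | hm
    · refine ⟨0, ?_⟩
      rw [pow_zero, pow_one] at hζ
      rw [pow_zero, pow_one, hζ, sub_self, mul_zero]
    · obtain ⟨r, hr⟩ := exists_add_pow_prime_pow_eq Nat.prime_two (ζ : unitBall E₁) (-1) m
      refine ⟨1 - ζ * r, ?_⟩
      rw [sub_eq_add_neg, hr, hζ, (Nat.even_pow.mpr ⟨even_two, hm.ne'⟩).neg_one_pow]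
      push_cast
      ring
  have hlt : ‖((((ζ - 1) ^ 2 ^ m : unitBall E₁)) : E₁)‖ < 1 := by
    rw [hc, Subring.coe_mul, norm_mul]
    calc ‖((2 : unitBall E₁) : E₁)‖ * ‖(c : E₁)‖ ≤ ‖((2 : unitBall E₁) : E₁)‖ * 1 :=
          mul_le_mul_of_nonneg_left ((mem_unitBall_iff E₁).mp c.2) (norm_nonneg _)
      _ < 1 := by rw [mul_one]; exact h2lt
  rw [SubmonoidClass.coe_pow, norm_pow] at hlt
  exact (pow_lt_one_iff_of_nonneg (norm_nonneg _) (pow_ne_zero m two_ne_zero)).mp hlt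

/-! ### §2. The evaluation `X ↦ ζ − 1` on `𝒪_F⟦X⟧` -/

/-- ★★ **The ring map `κ_ζ : 𝒪_F⟦X⟧ → 𝒪_{E'}`, `X ↦ ζ − 1`, EXISTS for `‖ζ − 1‖ < 1`** and fixes `𝒪_F` (`κ ∘ intBase = algebraMap`): Mathlib's
topological evaluation `PowerSeries.aeval` at the topologically nilpotent `ζ − 1` of the complete, linearly topologised `𝒪_F`-algebra `𝒪_{E'}`.
[cite: CasselsFrohlichANT1967, Ch. VI §3.2] [cite: deShalit1987, Ch. I §3.8 (17)] -/
theorem exists_ringHom_comp_intBase_eq_of_norm_lt_one {ζ : unitBall E₁} (hζ1 : ‖((ζ - 1 : unitBall E₁) : E₁)‖ < 1) :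
    ∃ κ : PowerSeries 𝒪[F] →+* unitBall E₁, κ.comp (intBase F) = algebraMap (LTCoeff F) (unitBall E₁) ∧ κ PowerSeries.X = ζ - 1 := by
  have hmem : (ζ - 1 : unitBall E₁) ∈ (maxNilIdeal F E₁).toIdeal := hζ1
  have hnil : PowerSeries.HasEval (ζ - 1 : unitBall E₁) :=
    (PowerSeries.hasEval_def _).mpr ((maxNilIdeal F E₁).isTopologicallyNilpotent _ hmem)
  refine ⟨(PowerSeries.aeval (R := LTCoeff F) hnil).toRingHom.comp (PowerSeries.map (LTCoeff.of F).toRingHom), ?_, ?_⟩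
  · refine RingHom.ext fun a => ?_
    change PowerSeries.aeval (R := LTCoeff F) hnil (PowerSeries.map (LTCoeff.of F).toRingHom (PowerSeries.C ((LTCoeff.of F).symm a))) = _
    rw [PowerSeries.map_C, RingEquiv.toRingHom_eq_coe, RingEquiv.coe_toRingHom, RingEquiv.apply_symm_apply,
      PowerSeries.coe_aeval hnil, PowerSeries.eval₂_C]
  · change PowerSeries.aeval (R := LTCoeff F) hnil (PowerSeries.map (LTCoeff.of F).toRingHom PowerSeries.X) = _
    rw [PowerSeries.map_X, PowerSeries.coe_aeval hnil, PowerSeries.eval₂_X]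

include hπ in
/-- ★★ **At `q = 2`: for `ζ ∈ 𝒪_{E'}` with `ζ^{2^m} = 1` there is a ring map `κ : 𝒪_F⟦X⟧ → 𝒪_{E'}` over `𝒪_F` with `κ(X) = ζ − 1`** — the ring data
posited by `LubinTateColemanUnitsImageSpecializationCharacterTwo` (§1 + §2). [cite: deShalit1987, Ch. I §3.1, §3.8 (17)] [cite: CasselsFrohlichANT1967, Ch. VI §3.2] -/
theorem exists_ringHom_comp_intBase_eq_of_pow_two_pow_eq_one (hq : residueFieldCard F = 2) {m : ℕ} {ζ : unitBall E₁} (hζ : ζ ^ 2 ^ m = 1) :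
    ∃ κ : PowerSeries 𝒪[F] →+* unitBall E₁, κ.comp (intBase F) = algebraMap (LTCoeff F) (unitBall E₁) ∧ κ PowerSeries.X = ζ - 1 :=
  exists_ringHom_comp_intBase_eq_of_norm_lt_one E₁ (norm_coe_sub_one_lt_one_of_pow_two_pow_eq_one hπ E₁ hq hζ)

/-! ### §3. The character `φ_m ↦ ζ` of `Gal(E_m/F)` -/

variable {p : ℕ} [hp : Fact p.Prime] {d : ℕ} [NeZero d]
variable (E : ℕ → IntermediateField F (AlgebraicClosure F)) [∀ m, FiniteDimensional F (E m)] [∀ m, Normal F (E m)] [∀ m, IsGalois F (E m)]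
  (hE : ∀ m, E m ≤ maxUnramified F) (hdeg : ∀ m, Module.finrank F (E m) = d * p ^ m)
  {σ₀ : absoluteGaloisGroup F} (hσ₀ : IsAbsArithFrob σ₀)

include hE hdeg hσ₀ in
/-- ★ **For `ζ^{p^m} = 1` in a commutative ring `S` there is a character `χ : Gal(E_m/F) →* S` with `χ(φ_m) = ζ`** (`Gal(E_m/F) = ⟨φ_m⟩` is cyclic of
order `[E_m : F] = d·p^m`, and the order of the unit `ζ` divides `p^m`). [cite: SerreLocalFields1979, Ch. I §4 Prop. 10] [cite: deShalit1987, Ch. I §3.1] -/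
theorem exists_monoidHom_apply_restrictNormal_eq (m : ℕ) {S : Type*} [CommRing S] (ζ : S) (hζ : ζ ^ p ^ m = 1) :
    ∃ χ : (E m ≃ₐ[F] E m) →* S, χ ((absoluteGaloisGroup.toAlgEquiv F σ₀).restrictNormal (E m)) = ζ := by
  have hpm : p ^ m ≠ 0 := pow_ne_zero m hp.out.ne_zero
  set ζu : Sˣ := Units.ofPowEqOne ζ (p ^ m) hζ hpm with hζu
  set φ := (absoluteGaloisGroup.toAlgEquiv F σ₀).restrictNormal (E m) with hφ
  have hg : ∀ σ : E m ≃ₐ[F] E m, σ ∈ Subgroup.zpowers φ := fun σ => by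
    obtain ⟨x, hx⟩ := (frobPow_bijective_cyclic p d E hE hdeg hσ₀ m).2 σ
    exact Subgroup.mem_zpowers_iff.mpr ⟨(x.val : ℤ), by rw [zpow_natCast]; exact hx⟩
  have hg' : orderOf ζu ∣ orderOf φ := by
    rw [hφ, orderOf_restrictNormal_eq_finrank (E m) (hE m) hσ₀, hdeg m]
    exact (orderOf_dvd_of_pow_eq_one (Units.pow_ofPowEqOne hζ hpm)).trans (dvd_mul_left _ _)
  refine ⟨(Units.coeHom S).comp (monoidHomOfForallMemZpowers hg hg'), ?_⟩
  rw [MonoidHom.comp_apply, monoidHomOfForallMemZpowers_apply_gen, Units.coeHom_apply, hζu, Units.val_ofPowEqOne]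

/-! ### §4. A finite subextension `E' ⊇ E₁` of `F̄` with a primitive `n`-th root of unity in `𝒪_{E'}` (`char F = 0`) -/

/-- ★ **The pair `(E', ζ)` EXISTS**: for `char F = 0`, every finite `E₁ ⊆ F̄` and every `n ≠ 0` there are a finite subextension `E' ⊇ E₁` of `F̄` and
a PRIMITIVE `n`-th root of unity `ζ ∈ 𝒪_{E'}` (`F̄` has enough roots of unity in characteristic `0`; `E' = E₁ ⊔ F(ζ₀)` is finite since `ζ₀` is
integral; `‖ζ₀‖^n = 1` forces `‖ζ₀‖ = 1`).  With §2–§3 every datum posited by the `χ`-readers of `LubinTateColemanUnitsImageSpecializationCharacterTwo`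
is realised. [cite: SerreLocalFields1979, Ch. IV §4 Prop. 16–17] [cite: deShalit1987, Ch. I §3.1] -/
theorem exists_intermediateField_le_isPrimitiveRoot [CharZero F] (n : ℕ) [NeZero n] :
    ∃ (E' : IntermediateField F (AlgebraicClosure F)) (_ : FiniteDimensional F E') (_ : E₁ ≤ E') (ζ : unitBall E'),
      IsPrimitiveRoot ζ n := by
  obtain ⟨ζ₀, hζ₀⟩ := HasEnoughRootsOfUnity.exists_primitiveRoot (AlgebraicClosure F) n
  have hint : IsIntegral F ζ₀ := (Algebra.IsAlgebraic.isAlgebraic (R := F) ζ₀).isIntegral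
  haveI : FiniteDimensional F (IntermediateField.adjoin F {ζ₀}) := IntermediateField.adjoin.finiteDimensional hint
  have hmem : ζ₀ ∈ E₁ ⊔ (IntermediateField.adjoin F {ζ₀}) :=
    (le_sup_right : (IntermediateField.adjoin F {ζ₀}) ≤ E₁ ⊔ (IntermediateField.adjoin F {ζ₀})) (IntermediateField.mem_adjoin_simple_self F ζ₀)
  have hpow : (⟨ζ₀, hmem⟩ : (E₁ ⊔ (IntermediateField.adjoin F {ζ₀}) : IntermediateField F (AlgebraicClosure F))) ^ n = 1 :=
    Subtype.ext (by rw [SubmonoidClass.coe_pow, OneMemClass.coe_one]; exact hζ₀.pow_eq_one)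
  have hnorm : ‖(⟨ζ₀, hmem⟩ : (E₁ ⊔ (IntermediateField.adjoin F {ζ₀}) : IntermediateField F (AlgebraicClosure F)))‖ ≤ 1 := by
    have h1 : ‖(⟨ζ₀, hmem⟩ : (E₁ ⊔ (IntermediateField.adjoin F {ζ₀}) : IntermediateField F (AlgebraicClosure F)))‖ ^ n = 1 := by
      rw [← norm_pow, hpow, norm_one]
    exact ((pow_eq_one_iff_of_nonneg (norm_nonneg _) (NeZero.ne n)).mp h1).le
  refine ⟨E₁ ⊔ (IntermediateField.adjoin F {ζ₀}), inferInstance, le_sup_left, ⟨⟨ζ₀, hmem⟩, (mem_unitBall_iff _).mpr hnorm⟩, ?_⟩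
  refine IsPrimitiveRoot.of_map_of_injective
    (f := (algebraMap (E₁ ⊔ (IntermediateField.adjoin F {ζ₀}) : IntermediateField F (AlgebraicClosure F)) (AlgebraicClosure F)).comp
      (unitBall (E₁ ⊔ (IntermediateField.adjoin F {ζ₀}) : IntermediateField F (AlgebraicClosure F))).subtype) ?_ ?_
  · exact hζ₀
  · exact (algebraMap (E₁ ⊔ (IntermediateField.adjoin F {ζ₀}) : IntermediateField F (AlgebraicClosure F)) (AlgebraicClosure F)).injective.comp
      Subtype.val_injective

end UnitsImageSpecializationCharacterDataTwo

end Literature.NumberTheory.GaloisRepresentations
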